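import Summits.BirchSwinnertonDyer.BirchSwinnertonDyer.Theorems.ResidualThetaTransportAtTwoAwayDefs
import Summits.BirchSwinnertonDyer.BirchSwinnertonDyer.Theorems.ResidualThetaTransportAtTwoResidualSignedLambdaLowerCMAtTwoCofreeSelmerTransferRelaxedAtTwo
import Summits.BirchSwinnertonDyer.BirchSwinnertonDyer.Theorems.ResidualThetaTransportAtTwoResidualSignedLambdaLowerCMAtTwoAwayExhaustion
import Summits.BirchSwinnertonDyer.BirchSwinnertonDyer.Theorems.ResidualThetaTransportAtTwoResidualSignedLambdaLowerCMAtTwoPlusPair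
import Literature.NumberTheory.EllipticCurves.Kato2004.IwasawaH1Reduction
import HarnessLib

/-!
# T1 (AtTwo package), part 1: LOCAL Kummer theory on `D₂ = H¹(ℚ_{∞,v}, A_ρ)` at `v ∣ 2` — every local class has a tower-Kummer datum,
# and the level value `(t(2^k Q) mod 2^k)·2^{-k}` of a class does not depend on the datum

Route `ResidualThetaTransportAtTwo` (RTT), crux RSL_g `ResidualSignedLambdaLowerCMAtTwo` (stmt-BirchSwinnertonDyer-22608), line «onepair», GLUE-SPEC-g18 §1
**T1 = the AtTwo package** (existence of `π₂ : AtTwoPins π` with (PERF₂)); seat `prover-bsd-wall-tp2-p2x-w2` g20 (`--supports`, closes nothing).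
THEOREMS ONLY (no definition, no named fact, no instance, no `sorry`). BSD is not proved by any of this; RSL_g (22608) stays OPEN.

The value pin `AtTwoPins.hc₂` of the local character `c₂ : 𝔉₂ →+ CharacterModule D₂` is written on LOCAL Θ-Kummer data: a cocycle `ψ` of
`U_{∞,v} = kerGroup κ v` with coefficients `A_ρ` whose Θ-transport is the Kummer cocycle of a tuple `Q` with `2^k Q ∈ E(ℚ_{∞,v})ⁿ`. This file is the
LOCAL twin of the global Kummer files of the line (`…CofreeSelmerTransferRelaxedAtTwo` §1 p695679, `…PlusValueWellDefined` p688548, `…PlusPair` p690960):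

* §1 `exists_pow_smul_localCocycle_eq_zero` — a cocycle of the COMPACT group `U_{∞,v}` with values in `A_ρ` is killed by one power of `2`.
* §2 **`exists_towerKummer_of_localCocycle`** — on the habitat (`GoodSS W 2`, `κ` cyclotomic, `v ∋ 2`) EVERY local cocycle `ψ` has a tower-Kummer
  datum `(Q, k)` (Coates–Greenberg: `H¹(ℚ_{∞,v}, E)[2^∞] = 0`, tree theorem `discreteH1_localPoints_eq_zero_of_pow_nsmul_eq_zero'`); class form
  **`exists_localKummerData`** for every `y ∈ D₂`.
* §3 `sub_sub_mem_localTowerPointsOfEmb_local`, **`levelValue_eq_of_localKummerData`** — two data of one class give the same level value for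
  every additive `t : (Fin n → E(ℚ_{∞,v})) →+ ℤ₂` (the well-definedness of `c₂`).

References: [CoatesGreenberg1996] Cor. 3.2; [GreenbergLNM1716] §2 pp. 83–84; [Kobayashi2003] (8.23) (p. 18); [MilneADT2006] I §6;
[SilvermanAEC2009] VIII §2; [SerreGaloisCohomology1997] I §2.2.
-/

set_option autoImplicit false
-- the Theorems namespace of this sub repeats the summit name by design (D-0017 nested layout)
set_option linter.dupNamespace false

noncomputable section

open scoped Classical

namespace Summit.BirchSwinnertonDyer.BirchSwinnertonDyer.Theorems.ThetaTransport.AtTwoPackage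

open CategoryTheory Field NumberField IsDedekindDomain WeierstrassCurve
  Literature.NumberTheory.EllipticCurves Literature.NumberTheory.GaloisRepresentations
  Literature.NumberTheory.EllipticCurves.GreenbergSelmer Literature.NumberTheory.EllipticCurves.CyclotomicLayer
  Literature.NumberTheory.EllipticCurves.Kobayashi2003 Literature.NumberTheory.EllipticCurves.Sprung2012
  Summit.BirchSwinnertonDyer.BirchSwinnertonDyer.Theorems.OnePair

variable (S : Set (PadicAlgCl 2)) {d : ℕ} (ρ : FramedGaloisRep ℚ ↥(padicCoeffIntegers S) d)
  (W : WeierstrassCurve ℚ) [W.IsElliptic] {r : ℕ} (Θ : Cofree ρ ↥(padicCoeffField S) ≃+ (Fin r → ↥(W.geomPrimaryTorsion 2)))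
  (κ : ZpExtension ℚ 2) (v : HeightOneSpectrum (𝓞 ℚ))
  (hΘ : ∀ (δ : absoluteGaloisGroup (v.adicCompletion ℚ)) (m : Cofree ρ ↥(padicCoeffField S)) (i : Fin r),
    Θ (resGalOfEmb (closureEmb (K := ℚ) (v.adicCompletion ℚ)) δ • m) i =
      resGalOfEmb (closureEmb (K := ℚ) (v.adicCompletion ℚ)) δ • Θ m i)

/-! ## §1 A uniform exponent for a local cocycle -/

omit [W.IsElliptic] in
include W Θ in
/-- A continuous cocycle of the COMPACT group `U_{∞,v} = kerGroup κ v` (closed in `Γ_{ℚ_v}`) with values in the discrete torsion module `A_ρ` has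
finitely many values, hence is killed by one power of `2`. [cite: SerreGaloisCohomology1997, I §2.2] -/
theorem exists_pow_smul_localCocycle_eq_zero
    (ψ : contOneCocycles (subgroupRep (localRepOf (cofreeGaloisModule S ρ) v) (kerGroup κ v))) :
    ∃ E : ℕ, ∀ τ : ↥(kerGroup κ v), (2 ^ E) • (ψ.1 τ : Cofree ρ ↥(padicCoeffField S)) = 0 := by
  haveI : CompactSpace (absoluteGaloisGroup (v.adicCompletion ℚ)) := absoluteGaloisGroup_compactSpace _
  haveI : CompactSpace ↥(kerGroup κ v) := isCompact_iff_compactSpace.mp (ProfiniteExhaustion.isClosed_kerGroup κ v).isCompact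
  have hfin : (Set.range (ψ.1 : ↥(kerGroup κ v) → Cofree ρ ↥(padicCoeffField S))).Finite :=
    (isCompact_range ψ.1.continuous).finite_of_discrete
  choose e he using fun a : Cofree ρ ↥(padicCoeffField S) ↦ PlusValue.exists_pow_smul_cofree_eq_zero W Θ a
  refine ⟨hfin.toFinset.sup e, fun τ ↦ ?_⟩
  obtain ⟨c, hc⟩ := Nat.exists_eq_add_of_le (Finset.le_sup (f := e) (hfin.mem_toFinset.mpr ⟨τ, rfl⟩))
  rw [hc, pow_add, mul_comm, mul_smul, he, smul_zero]

/-! ## §2 Every local class has a tower-Kummer datum -/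

include hΘ in
/-- **Every LOCAL cocycle at `v ∣ 2` is tower-Kummer** (local twin of p695679 `exists_towerKummer_of_cocycle`). On the habitat (`GoodSS W 2`,
`κ` cyclotomic, `v ∋ 2`), for every continuous cocycle `ψ` of `U_{∞,v}` with coefficients `A_ρ` there are `Q : Fin n → E(K̄_v)` and `k` with
`2^k Q_i ∈ E(ℚ_{∞,v})` and `ι(Θ(ψ τ)_i) = τ Q_i − Q_i` for all `τ ∈ U_{∞,v}`: the transported coordinate cocycles `τ ↦ ι(Θ(ψ τ)_i) ∈ E(K̄_v)` have
finite range (`U_{∞,v}` compact), so their classes are `2^m`-torsion in `H¹(U_{∞,v}, E(K̄_v))`, which has no `2`-power torsion (Coates–Greenberg,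
`discreteH1_localPoints_eq_zero_of_pow_nsmul_eq_zero'`). [cite: CoatesGreenberg1996, Cor. 3.2] [cite: GreenbergLNM1716, §2 pp. 83–84] -/
theorem exists_towerKummer_of_localCocycle [W.IsGloballyMinimal] (hGood : Rank1Residual.GoodSS W 2) (hκ : κ.IsCyclotomic)
    (hv : ((2 : ℕ) : 𝓞 ℚ) ∈ v.asIdeal)
    (ψ : contOneCocycles (subgroupRep (localRepOf (cofreeGaloisModule S ρ) v) (kerGroup κ v))) :
    ∃ (Q : Fin r → localPoints W (v.adicCompletion ℚ)) (k : ℕ),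
      (∀ i, (2 ^ k) • Q i ∈ localTowerPointsOfEmb κ (closureEmb (K := ℚ) (v.adicCompletion ℚ)) W) ∧
      ∀ (τ : ↥(kerGroup κ v)) (i : Fin r),
        pointsMapOfEmb W (closureEmb (K := ℚ) (v.adicCompletion ℚ))
          ((Θ (ψ.1 τ) i : ↥(W.geomPrimaryTorsion 2)) : W.geomPoints) = (τ : absoluteGaloisGroup (v.adicCompletion ℚ)) • Q i - Q i := by
  -- habitat at `v ∋ 2`
  have hgood : W.HasGoodReductionAt v := W.hasGoodReductionAt_of_hasGoodReductionAtPrime v hv hGood.1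
  have hss : ¬ W.HasUnitRootAt v := by
    rw [W.hasUnitRootAt_iff_not_dvd_frobeniusTrace v Nat.prime_two hv, not_not]; exact hGood.2
  -- a uniform exponent
  obtain ⟨m, hm⟩ := exists_pow_smul_localCocycle_eq_zero S ρ W Θ κ v ψ
  -- the coordinate maps `A_ρ →+ E(K̄_v)`, `a ↦ ι(Θ(a)_i)`, equivariant for `U_{∞,v}`
  let G : ↥(W.geomPrimaryTorsion 2) →+ localPoints W (v.adicCompletion ℚ) :=
    (pointsMapOfEmb W (closureEmb (K := ℚ) (v.adicCompletion ℚ))).comp (W.geomPrimaryTorsion 2).subtype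
  let F : Fin r → (Cofree ρ ↥(padicCoeffField S) →+ localPoints W (v.adicCompletion ℚ)) := fun i ↦
    G.comp ((Pi.evalAddMonoidHom (fun _ : Fin r ↦ ↥(W.geomPrimaryTorsion 2)) i).comp Θ.toAddMonoidHom)
  have hF : ∀ (i : Fin r) (τ : ↥(kerGroup κ v)) (a : Cofree ρ ↥(padicCoeffField S)),
      F i ((subgroupRep (localRepOf (cofreeGaloisModule S ρ) v) (kerGroup κ v)).ρ τ a) =
        (discreteTopRep ↥(kerGroup κ v) (localPoints W (v.adicCompletion ℚ))).ρ τ (F i a) := by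
    intro i τ a
    change G (Θ (resGalOfEmb (closureEmb (K := ℚ) (v.adicCompletion ℚ)) (τ : absoluteGaloisGroup (v.adicCompletion ℚ)) • a) i) =
      (τ : absoluteGaloisGroup (v.adicCompletion ℚ)) • G (Θ a i)
    rw [hΘ]
    simp only [G, AddMonoidHom.coe_comp, AddSubgroup.coe_subtype, Function.comp_apply, primaryComponent.coe_smul]
    exact pointsMapOfEmb_smul W _ _ _
  -- the transported coordinate cocycles are `2^m`-torsion, hence their classes vanish
  let P : Fin r → contOneCocycles (discreteTopRep ↥(kerGroup κ v) (localPoints W (v.adicCompletion ℚ))) := fun i ↦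
    contOneCocycles.pushAddHom (F i) continuous_of_discreteTopology (hF i) ψ
  have hP : ∀ i, (2 ^ m) • P i = 0 := by
    intro i
    refine Subtype.ext (ContinuousMap.ext fun τ ↦ ?_)
    change (2 ^ m) • G (Θ (ψ.1 τ) i) = (0 : localPoints W (v.adicCompletion ℚ))
    rw [← map_nsmul, ← Pi.smul_apply, ← map_nsmul, hm τ, map_zero, Pi.zero_apply, map_zero]
  have hzero : ∀ i, oneCocycleClass _ (P i) = 0 := by
    intro i
    have e := map_nsmul (oneCocycleClassₗ (discreteTopRep ↥(kerGroup κ v) (localPoints W (v.adicCompletion ℚ)))) (2 ^ m) (P i)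
    rw [hP i, map_zero, oneCocycleClassₗ_apply] at e
    exact CofreeSelmerTransfer.discreteH1_localPoints_eq_zero_of_pow_nsmul_eq_zero' W κ hκ hv hgood hss m _ e.symm
  -- read off the Kummer representatives
  have hQ : ∀ i, ∃ Q : localPoints W (v.adicCompletion ℚ), ∀ τ : ↥(kerGroup κ v),
      F i (ψ.1 τ) = (τ : absoluteGaloisGroup (v.adicCompletion ℚ)) • Q - Q := fun i ↦ by
    obtain ⟨Q, hQ⟩ := (oneCocycleClass_eq_zero_iff _ (P i)).mp (hzero i)
    exact ⟨Q, fun τ ↦ hQ τ⟩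
  choose Q hQ using hQ
  refine ⟨Q, m, fun i ↦ ?_, fun τ i ↦ hQ i τ⟩
  rw [mem_localTowerPointsOfEmb_iff]
  intro τ hτ
  have h2 : (2 ^ m) • F i (ψ.1 ⟨τ, hτ⟩) = 0 := by
    change (2 ^ m) • G (Θ (ψ.1 ⟨τ, hτ⟩) i) = 0
    rw [← map_nsmul, ← Pi.smul_apply, ← map_nsmul, hm, map_zero, Pi.zero_apply, map_zero]
  rw [hQ i ⟨τ, hτ⟩, smul_sub, sub_eq_zero, smul_comm] at h2
  exact h2

include hΘ in
/-- **Every class `y ∈ D₂ = H¹(ℚ_{∞,v}, A_ρ)` has a local tower-Kummer datum `(ψ, Q, k)`** (class form of §2): the EXISTENCE half of the data on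
which `AtTwoPins.hc₂` pins `c₂` (uniqueness of the value = §3). [cite: CoatesGreenberg1996, Cor. 3.2] [cite: Kobayashi2003, (8.23) (p. 18)] -/
theorem exists_localKummerData [W.IsGloballyMinimal] (hGood : Rank1Residual.GoodSS W 2) (hκ : κ.IsCyclotomic)
    (hv : ((2 : ℕ) : 𝓞 ℚ) ∈ v.asIdeal)
    (y : continuousCohomology 1 (subgroupRep (localRepOf (cofreeGaloisModule S ρ) v) (kerGroup κ v))) :
    ∃ (ψ : contOneCocycles (subgroupRep (localRepOf (cofreeGaloisModule S ρ) v) (kerGroup κ v)))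
      (Q : Fin r → localPoints W (v.adicCompletion ℚ)) (k : ℕ),
      oneCocycleClass _ ψ = y ∧
      (∀ i, (2 ^ k) • Q i ∈ localTowerPointsOfEmb κ (closureEmb (K := ℚ) (v.adicCompletion ℚ)) W) ∧
      ∀ (τ : ↥(kerGroup κ v)) (i : Fin r),
        pointsMapOfEmb W (closureEmb (K := ℚ) (v.adicCompletion ℚ))
          ((Θ (ψ.1 τ) i : ↥(W.geomPrimaryTorsion 2)) : W.geomPoints) = (τ : absoluteGaloisGroup (v.adicCompletion ℚ)) • Q i - Q i := by
  obtain ⟨ψ, rfl⟩ := oneCocycleClass_surjective _ y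
  obtain ⟨Q, k, hQ, hK⟩ := exists_towerKummer_of_localCocycle S ρ W Θ κ v hΘ hGood hκ hv ψ
  exact ⟨ψ, Q, k, rfl, hQ, hK⟩

/-! ## §3 The level value does not depend on the local datum -/

omit [W.IsElliptic] in
include hΘ in
/-- **Two local Kummer representatives of one class differ by a tower point** (local twin of `PlusValue.sub_sub_mem_localTowerPointsOfEmb`): if
`ψ − ψ' = ∂a` on `U_{∞,v}` and `Q, Q'` are Kummer tuples of `ψ, ψ'`, then `Q_i − Q'_i − ι(Θ a)_i ∈ E(ℚ_{∞,v})`. [cite: SilvermanAEC2009, VIII §2]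
[cite: MilneADT2006, Ch. I §6] -/
theorem sub_sub_mem_localTowerPointsOfEmb_local
    (ψ ψ' : contOneCocycles (subgroupRep (localRepOf (cofreeGaloisModule S ρ) v) (kerGroup κ v)))
    (a : Cofree ρ ↥(padicCoeffField S))
    (ha : ∀ τ : ↥(kerGroup κ v), (ψ.1 τ : Cofree ρ ↥(padicCoeffField S)) - ψ'.1 τ =
      resGalOfEmb (closureEmb (K := ℚ) (v.adicCompletion ℚ)) (τ : absoluteGaloisGroup (v.adicCompletion ℚ)) • a - a)
    (Q Q' : Fin r → localPoints W (v.adicCompletion ℚ))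
    (hK : ∀ (τ : ↥(kerGroup κ v)) (i : Fin r), pointsMapOfEmb W (closureEmb (K := ℚ) (v.adicCompletion ℚ))
      ((Θ (ψ.1 τ) i : ↥(W.geomPrimaryTorsion 2)) : W.geomPoints) = (τ : absoluteGaloisGroup (v.adicCompletion ℚ)) • Q i - Q i)
    (hK' : ∀ (τ : ↥(kerGroup κ v)) (i : Fin r), pointsMapOfEmb W (closureEmb (K := ℚ) (v.adicCompletion ℚ))
      ((Θ (ψ'.1 τ) i : ↥(W.geomPrimaryTorsion 2)) : W.geomPoints) = (τ : absoluteGaloisGroup (v.adicCompletion ℚ)) • Q' i - Q' i)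
    (i : Fin r) :
    Q i - Q' i - pointsMapOfEmb W (closureEmb (K := ℚ) (v.adicCompletion ℚ)) ((Θ a i : ↥(W.geomPrimaryTorsion 2)) : W.geomPoints) ∈
      localTowerPointsOfEmb κ (closureEmb (K := ℚ) (v.adicCompletion ℚ)) W := by
  rw [mem_localTowerPointsOfEmb_iff]
  intro τ hτ
  have h1 := hK ⟨τ, hτ⟩ i
  have h2 := hK' ⟨τ, hτ⟩ i
  have h3 : ((Θ (ψ.1 ⟨τ, hτ⟩) i : ↥(W.geomPrimaryTorsion 2)) : W.geomPoints) - ((Θ (ψ'.1 ⟨τ, hτ⟩) i : ↥(W.geomPrimaryTorsion 2)) : W.geomPoints) =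
      resGalOfEmb (closureEmb (K := ℚ) (v.adicCompletion ℚ)) τ • ((Θ a i : ↥(W.geomPrimaryTorsion 2)) : W.geomPoints) -
        ((Θ a i : ↥(W.geomPrimaryTorsion 2)) : W.geomPoints) := by
    rw [← AddSubgroupClass.coe_sub, ← Pi.sub_apply, ← map_sub, ha ⟨τ, hτ⟩, map_sub, Pi.sub_apply, AddSubgroupClass.coe_sub, hΘ]
    rfl
  have h4 := congrArg (pointsMapOfEmb W (closureEmb (K := ℚ) (v.adicCompletion ℚ))) h3
  rw [map_sub, h1, h2, map_sub, pointsMapOfEmb_smul] at h4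
  rw [smul_sub, smul_sub]
  have h5 : τ • Q i - τ • Q' i - τ • pointsMapOfEmb W (closureEmb (K := ℚ) (v.adicCompletion ℚ)) ((Θ a i : ↥(W.geomPrimaryTorsion 2)) : W.geomPoints) -
      (Q i - Q' i - pointsMapOfEmb W (closureEmb (K := ℚ) (v.adicCompletion ℚ)) ((Θ a i : ↥(W.geomPrimaryTorsion 2)) : W.geomPoints)) = 0 := by
    have := sub_eq_zero.mpr h4
    rw [← this]
    abel
  exact sub_eq_zero.mp h5

omit [W.IsElliptic] in
include hΘ in
/-- **The level value of a local class does not depend on the Kummer datum.** For `y ∈ D₂` and two local data `(ψ, Q, k)`, `(ψ', Q', k')` of `y`, every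
additive `t : (Fin n → E(ℚ_{∞,v})) →+ ℤ₂` gives `(t(2^kQ) mod 2^k)·2^{-k} = (t(2^{k'}Q') mod 2^{k'})·2^{-k'}` in `ℚ/ℤ` (local twin of
`PlusValue.levelValue_eq_of_kummerData`: `ψ − ψ' = ∂a`, `2^e a = 0`, `R = Q − Q' − ι Θ a` is a tower point, `PlusValue.levelValue_eq_of_pow_mul_sub_mem`).
[cite: Kobayashi2003, (8.23) (p. 18)] [cite: MilneADT2006, Ch. I §6] -/
theorem levelValue_eq_of_localKummerData
    (t : (Fin r → ↥(localTowerPointsOfEmb κ (closureEmb (K := ℚ) (v.adicCompletion ℚ)) W)) →+ ℤ_[2])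
    (ψ ψ' : contOneCocycles (subgroupRep (localRepOf (cofreeGaloisModule S ρ) v) (kerGroup κ v)))
    (hψ : oneCocycleClass _ ψ = oneCocycleClass _ ψ')
    (Q Q' : Fin r → localPoints W (v.adicCompletion ℚ)) (k k' : ℕ)
    (hQ : ∀ i, (2 ^ k) • Q i ∈ localTowerPointsOfEmb κ (closureEmb (K := ℚ) (v.adicCompletion ℚ)) W)
    (hQ' : ∀ i, (2 ^ k') • Q' i ∈ localTowerPointsOfEmb κ (closureEmb (K := ℚ) (v.adicCompletion ℚ)) W)
    (hK : ∀ (τ : ↥(kerGroup κ v)) (i : Fin r), pointsMapOfEmb W (closureEmb (K := ℚ) (v.adicCompletion ℚ))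
      ((Θ (ψ.1 τ) i : ↥(W.geomPrimaryTorsion 2)) : W.geomPoints) = (τ : absoluteGaloisGroup (v.adicCompletion ℚ)) • Q i - Q i)
    (hK' : ∀ (τ : ↥(kerGroup κ v)) (i : Fin r), pointsMapOfEmb W (closureEmb (K := ℚ) (v.adicCompletion ℚ))
      ((Θ (ψ'.1 τ) i : ↥(W.geomPrimaryTorsion 2)) : W.geomPoints) = (τ : absoluteGaloisGroup (v.adicCompletion ℚ)) • Q' i - Q' i) :
    ((PadicInt.toZModPow k (t (fun i ↦ ⟨(2 ^ k) • Q i, hQ i⟩))).val • ((((2 : ℚ) ^ k)⁻¹ : ℚ) : AddCircle (1 : ℚ)) : AddCircle (1 : ℚ)) =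
      (PadicInt.toZModPow k' (t (fun i ↦ ⟨(2 ^ k') • Q' i, hQ' i⟩))).val • ((((2 : ℚ) ^ k')⁻¹ : ℚ) : AddCircle (1 : ℚ)) := by
  -- `ψ − ψ' = ∂a`
  have h0 : oneCocycleClass _ (ψ - ψ') = 0 := by rw [oneCocycleClass_sub, hψ, sub_self]
  obtain ⟨a, ha⟩ := (oneCocycleClass_eq_zero_iff _ _).mp h0
  have ha' : ∀ τ : ↥(kerGroup κ v), (ψ.1 τ : Cofree ρ ↥(padicCoeffField S)) - ψ'.1 τ =
      resGalOfEmb (closureEmb (K := ℚ) (v.adicCompletion ℚ)) (τ : absoluteGaloisGroup (v.adicCompletion ℚ)) • a - a := fun τ ↦ ha τ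
  obtain ⟨e, he⟩ := PlusValue.exists_pow_smul_theta_eq_zero W Θ a
  obtain ⟨P, hP⟩ : ∃ P : Fin r → localPoints W (v.adicCompletion ℚ), ∀ i,
      P i = pointsMapOfEmb W (closureEmb (K := ℚ) (v.adicCompletion ℚ)) ((Θ a i : ↥(W.geomPrimaryTorsion 2)) : W.geomPoints) :=
    ⟨_, fun _ ↦ rfl⟩
  have hR : ∀ i, Q i - Q' i - P i ∈ localTowerPointsOfEmb κ (closureEmb (K := ℚ) (v.adicCompletion ℚ)) W := fun i ↦ by
    rw [hP i]
    exact sub_sub_mem_localTowerPointsOfEmb_local S ρ W Θ κ v hΘ ψ ψ' a ha' Q Q' hK hK' i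
  have hPe : ∀ i, (2 ^ e) • P i = 0 := fun i ↦ by rw [hP i, ← map_nsmul, he i, map_zero]
  have e1 : 2 ^ (k' + e) * 2 ^ k = 2 ^ (k + k') * 2 ^ e := by ring
  have e2 : 2 ^ (k + e) * 2 ^ k' = 2 ^ (k + k') * 2 ^ e := by ring
  have hid : (2 ^ (k' + e)) • (fun i ↦ (⟨(2 ^ k) • Q i, hQ i⟩ : ↥(localTowerPointsOfEmb κ (closureEmb (K := ℚ) (v.adicCompletion ℚ)) W))) -
      (2 ^ (k + e)) • (fun i ↦ (⟨(2 ^ k') • Q' i, hQ' i⟩ : ↥(localTowerPointsOfEmb κ (closureEmb (K := ℚ) (v.adicCompletion ℚ)) W))) =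
      (2 ^ (k + k' + e)) • (fun i ↦ (⟨Q i - Q' i - P i, hR i⟩ : ↥(localTowerPointsOfEmb κ (closureEmb (K := ℚ) (v.adicCompletion ℚ)) W))) := by
    funext i
    apply Subtype.ext
    simp only [Pi.sub_apply, Pi.smul_apply, AddSubgroupClass.coe_sub, AddSubgroupClass.coe_nsmul]
    rw [smul_sub, smul_sub, pow_add 2 (k + k') e, mul_smul (2 ^ (k + k')) (2 ^ e) (P i), hPe i, smul_zero, sub_zero,
      smul_smul, smul_smul, e1, e2]
  have ht := congrArg t hid
  rw [map_sub, map_nsmul, map_nsmul, map_nsmul] at ht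
  refine PlusValue.levelValue_eq_of_pow_mul_sub_mem k k' e _ _ ?_
  rw [nsmul_eq_mul, nsmul_eq_mul, nsmul_eq_mul, Nat.cast_pow, Nat.cast_pow, Nat.cast_pow] at ht
  rw [ht]
  exact Ideal.mul_mem_right _ _ (Ideal.mem_span_singleton_self _)

end Summit.BirchSwinnertonDyer.BirchSwinnertonDyer.Theorems.ThetaTransport.AtTwoPackage

end
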